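import Summits.CriticalPhenomena.PercolationContinuityZ3.Theses.PercMinContact
import Summits.CriticalPhenomena.PercolationContinuityZ3.Theorems.PercMinContactSwallowInequalityTransport
import HarnessLib

/-!
# Route PercMinContact — support `SwallowInequality` (stmt-CriticalPhenomena-11500)

The swallow inequality (unfactorised Aizenman–Barsky / Russo bound): for bond percolation on
`ℤ³` and every real `p < p_c`,
`θ(p_c) ≤ ∫_{(p,p_c)} (1-u)⁻¹ m(u) du`, `m(u) = E_u[Σ_{y ∼ 0} 1{0 ↮ y} min(|C(0)|, |C(y)|)]`
(`swallowInequality_proof : Theses.PercMinContact.SwallowInequality`).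

Proof: truncated probe `f_N(u) = N⁻¹ Σ_{k ≤ N} P_u(|C(0)| ≥ k)` (local increasing events),
Russo's formula, resampling of the pivotal edge, cluster surgery (opening a closed boundary edge
merges exactly the two clusters at its endpoints), the mass-transport principle for the
translations of `ℤ^d`, the kernel bound `a · #{k ≤ N : a < k ≤ a + b} ≤ N min(a, b)` — giving the
MAIN ESTIMATE `D_N(u) ≤ (1-u)⁻¹ m(u)` (`ofReal_DN_le`) — then the fundamental theorem of calculus
on `[a, p_c] ⊆ (0, 1)`, `θ(p_c) ≤ f_N(p_c)`, and `f_N(a) → 0` for `a < p_c` (`θ(a) = 0`, continuity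
of the measure, Cesàro). Parts 1–2: `PercMinContactSwallowInequalityProbe.lean`,
`PercMinContactSwallowInequalityTransport.lean`. Sources: Grimmett (1999) §2.4, §5.3;
Aizenman–Barsky (1987); Russo (1981); Hutchcroft (2020) §2–3.
-/

noncomputable section

namespace Summit.CriticalPhenomena.PercolationContinuityZ3.Theorems

open MeasureTheory Filter Literature.Probability.Percolation Literature.Probability.LatticeModels
open scoped Topology ENNReal

namespace SwallowIneq

/-! ### The main estimate `D_N(u) ≤ (1-u)⁻¹ m(u)` -/

section Main

variable {d : ℕ}

/-- **The main estimate**: for `N ≥ 1` and `u ∈ (0, 1)`, `D_N(u) ≤ (1 - u)⁻¹ m(u)`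
(Russo + resampling + merger bound + mass transport + kernel bound). -/
theorem ofReal_DN_le {N : ℕ} (hN : 1 ≤ N) {u : ℝ} (hu : u ∈ Set.Ioo (0 : ℝ) 1) :
    ENNReal.ofReal (DN d N u) ≤ ENNReal.ofReal ((1 - u)⁻¹) * mfun d u := by
  classical
  have hqu : ((Set.projIcc (0 : ℝ) 1 zero_le_one u : unitInterval) : ℝ) = u := by
    rw [Set.projIcc_of_mem _ ⟨hu.1.le, hu.2.le⟩]
  set μ := P d u with hμ
  have h1u : 0 < 1 - u := by linarith [hu.2]
  set S := ∑ k ∈ Finset.Icc 1 N, ∑ e ∈ edgesN d N, μ.real (pivEvent d k e) with hS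
  -- Step 1: resampling, and relabelling the edges by `(v, i)`
  have step1 : (1 - u) * S = ∑ ℓ ∈ labels d N, ∑ k ∈ Finset.Icc 1 N,
      μ.real (pivEvent d k (TwoGhost.edgeOf ℓ) ∩ {ω | TwoGhost.edgeOf ℓ ∉ ω}) := by
    rw [hS, Finset.sum_comm, Finset.mul_sum]
    unfold edgesN
    rw [Finset.sum_image (fun ℓ _ ℓ' _ h => TwoGhost.edgeOf_injective h)]
    refine Finset.sum_congr rfl fun ℓ hℓ => ?_
    rw [Finset.mul_sum]
    refine Finset.sum_congr rfl fun k hk => ?_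
    rw [hμ, real_pivEvent_inter_notMem (Finset.mem_Icc.1 hk).2 u (Finset.mem_image_of_mem _ hℓ), hqu,
      mul_comm]
  -- Step 2: as an expectation
  have hmeas : ∀ (ℓ : Site d × Fin d) (k : ℕ),
      MeasurableSet (pivEvent d k (TwoGhost.edgeOf ℓ) ∩ {ω | TwoGhost.edgeOf ℓ ∉ ω}) :=
    fun ℓ k => (measurableSet_pivEvent d k _).inter (measurableSet_notMem _)
  have step2 : ENNReal.ofReal (∑ ℓ ∈ labels d N, ∑ k ∈ Finset.Icc 1 N,
      μ.real (pivEvent d k (TwoGhost.edgeOf ℓ) ∩ {ω | TwoGhost.edgeOf ℓ ∉ ω})) =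
      ∫⁻ ω, ∑ ℓ ∈ labels d N, ∑ k ∈ Finset.Icc 1 N,
        (pivEvent d k (TwoGhost.edgeOf ℓ) ∩ {ω | TwoGhost.edgeOf ℓ ∉ ω}).indicator 1 ω ∂μ := by
    rw [ENNReal.ofReal_sum_of_nonneg (fun _ _ => Finset.sum_nonneg fun _ _ => measureReal_nonneg),
      lintegral_finsetSum _ (fun ℓ _ => Finset.measurable_sum _ fun k _ =>
        (measurable_one.indicator (hmeas ℓ k)))]
    refine Finset.sum_congr rfl fun ℓ _ => ?_
    rw [ENNReal.ofReal_sum_of_nonneg (fun _ _ => measureReal_nonneg),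
      lintegral_finsetSum _ (fun k _ => measurable_one.indicator (hmeas ℓ k))]
    refine Finset.sum_congr rfl fun k _ => ?_
    rw [lintegral_indicator_one (hmeas ℓ k), ofReal_measureReal (measure_ne_top _ _)]
  -- Step 3: the merger bound, pointwise on lattice configurations
  have step3 : ∫⁻ ω, ∑ ℓ ∈ labels d N, ∑ k ∈ Finset.Icc 1 N,
        (pivEvent d k (TwoGhost.edgeOf ℓ) ∩ {ω | TwoGhost.edgeOf ℓ ∉ ω}).indicator 1 ω ∂μ ≤
      ∫⁻ ω, ∑ i : Fin d, ∑' v : Site d, (hfun N v (v + Pi.single i 1) ω +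
        hfun N (v + Pi.single i 1) v ω) ∂μ := by
    refine lintegral_mono_ae ?_
    filter_upwards [ae_subset_edgeSet (d := d) u] with ω hω
    calc ∑ ℓ ∈ labels d N, ∑ k ∈ Finset.Icc 1 N,
          (pivEvent d k (TwoGhost.edgeOf ℓ) ∩ {ω | TwoGhost.edgeOf ℓ ∉ ω}).indicator 1 ω
        ≤ ∑ ℓ ∈ labels d N, (hfun N ℓ.1 (ℓ.1 + Pi.single ℓ.2 1) ω + hfun N (ℓ.1 + Pi.single ℓ.2 1) ℓ.1 ω) :=
          Finset.sum_le_sum fun ℓ _ => sum_indicator_piv_le hω N (TwoGhost.edgeOf_mem_edgeSet ℓ)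
      _ = ∑ i : Fin d, ∑ v ∈ box d N, (hfun N v (v + Pi.single i 1) ω + hfun N (v + Pi.single i 1) v ω) := by
          rw [labels, Finset.sum_product, Finset.sum_comm]
      _ ≤ ∑ i : Fin d, ∑' v : Site d, (hfun N v (v + Pi.single i 1) ω + hfun N (v + Pi.single i 1) v ω) :=
          Finset.sum_le_sum fun i _ => ENNReal.sum_le_tsum _
  -- Step 4: mass transport
  have step4 : ∫⁻ ω, ∑ i : Fin d, ∑' v : Site d, (hfun N v (v + Pi.single i 1) ω +
        hfun N (v + Pi.single i 1) v ω) ∂μ =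
      ∫⁻ ω, (openCluster ω 0).encard * ∑ y ∈ (zdGraph d).neighborFinset (0 : Site d), Hfun N y ω ∂μ := by
    -- each coordinate direction
    have hdir : ∀ i : Fin d,
        ∫⁻ ω, ∑' v : Site d, (hfun N v (v + Pi.single i 1) ω + hfun N (v + Pi.single i 1) v ω) ∂μ =
        ∫⁻ ω, (openCluster ω 0).encard * (Hfun N (Pi.single i 1) ω + Hfun N (-Pi.single i 1) ω) ∂μ := by
      intro i
      have e1 : ∫⁻ ω, ∑' v : Site d, (hfun N v (v + Pi.single i 1) ω + hfun N (v + Pi.single i 1) v ω) ∂μ =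
          ∑' v : Site d, ∫⁻ ω, (hfun N v (v + Pi.single i 1) ω + hfun N (v + Pi.single i 1) v ω) ∂μ :=
        lintegral_tsum fun v => ((measurable_hfun N _ _).add (measurable_hfun N _ _)).aemeasurable
      have e2 : ∑' v : Site d, ∫⁻ ω, (hfun N v (v + Pi.single i 1) ω + hfun N (v + Pi.single i 1) v ω) ∂μ =
          ∑' v : Site d, ((∫⁻ ω, hfun N v (v + Pi.single i 1) ω ∂μ) +
            ∫⁻ ω, hfun N (v + Pi.single i 1) v ω ∂μ) :=
        tsum_congr fun v => lintegral_add_left (measurable_hfun N _ _) _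
      have hA := tsum_lintegral_hfun (d := d) N u (Pi.single i 1) (Equiv.refl _)
      simp only [Equiv.refl_apply] at hA
      have hB := tsum_lintegral_hfun (d := d) N u (-Pi.single i 1) (Equiv.addRight (Pi.single i 1))
      simp only [Equiv.coe_addRight, add_neg_cancel_right] at hB
      have hm : Measurable fun ω : BondConfig (Site d) =>
          ((openCluster ω 0).encard : ℝ≥0∞) * Hfun N (Pi.single i 1) ω :=
        (measurable_encard_ennreal 0).mul (measurable_Hfun _ _)
      have e3 : (∫⁻ ω, ((openCluster ω 0).encard : ℝ≥0∞) * Hfun N (Pi.single i 1) ω ∂(P d u)) +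
            ∫⁻ ω, ((openCluster ω 0).encard : ℝ≥0∞) * Hfun N (-Pi.single i 1) ω ∂(P d u) =
          ∫⁻ ω, (((openCluster ω 0).encard : ℝ≥0∞) * Hfun N (Pi.single i 1) ω +
            ((openCluster ω 0).encard : ℝ≥0∞) * Hfun N (-Pi.single i 1) ω) ∂(P d u) :=
        (lintegral_add_left hm _).symm
      rw [e1, e2, ENNReal.tsum_add, hμ, hA, hB, e3]
      refine lintegral_congr fun ω => ?_
      rw [mul_add]
    have e4 : ∫⁻ ω, ∑ i : Fin d, ∑' v : Site d, (hfun N v (v + Pi.single i 1) ω +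
          hfun N (v + Pi.single i 1) v ω) ∂μ =
        ∑ i : Fin d, ∫⁻ ω, ∑' v : Site d, (hfun N v (v + Pi.single i 1) ω +
          hfun N (v + Pi.single i 1) v ω) ∂μ :=
      lintegral_finsetSum _ fun i _ =>
        Measurable.tsum fun v => (measurable_hfun N _ _).add (measurable_hfun N _ _)
    have e5 : ∫⁻ ω, ∑ i : Fin d, ((openCluster ω 0).encard : ℝ≥0∞) *
          (Hfun N (Pi.single i 1) ω + Hfun N (-Pi.single i 1) ω) ∂μ =
        ∑ i : Fin d, ∫⁻ ω, ((openCluster ω 0).encard : ℝ≥0∞) *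
          (Hfun N (Pi.single i 1) ω + Hfun N (-Pi.single i 1) ω) ∂μ :=
      lintegral_finsetSum _ fun i _ =>
        (measurable_encard_ennreal 0).mul ((measurable_Hfun _ _).add (measurable_Hfun _ _))
    rw [e4, Finset.sum_congr rfl fun i _ => hdir i, ← e5]
    refine lintegral_congr fun ω => ?_
    rw [sum_neighborFinset_zero, Finset.mul_sum]
  -- Step 5: assemble
  have key : ENNReal.ofReal ((1 - u) * S) ≤ N * mfun d u :=
    calc ENNReal.ofReal ((1 - u) * S)
        = ∫⁻ ω, ∑ ℓ ∈ labels d N, ∑ k ∈ Finset.Icc 1 N,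
            (pivEvent d k (TwoGhost.edgeOf ℓ) ∩ {ω | TwoGhost.edgeOf ℓ ∉ ω}).indicator 1 ω ∂μ := by
          rw [step1, step2]
      _ ≤ _ := step3
      _ = _ := step4
      _ ≤ N * mfun d u := lintegral_encard_mul_sum_Hfun_le N u
  have hDN : DN d N u = (1 - u)⁻¹ * ((N : ℝ)⁻¹ * ((1 - u) * S)) := by
    rw [show DN d N u = (N : ℝ)⁻¹ * S from rfl, mul_left_comm ((N : ℝ)⁻¹) (1 - u) S,
      inv_mul_cancel_left₀ h1u.ne']
  have hN0 : (N : ℝ≥0∞) ≠ 0 := by exact_mod_cast (show N ≠ 0 by omega)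
  have hNpos : (0 : ℝ) < N := by exact_mod_cast hN
  calc ENNReal.ofReal (DN d N u)
      = ENNReal.ofReal ((1 - u)⁻¹) * (ENNReal.ofReal ((N : ℝ)⁻¹) * ENNReal.ofReal ((1 - u) * S)) := by
        rw [hDN, ENNReal.ofReal_mul (inv_nonneg.2 h1u.le),
          ENNReal.ofReal_mul (inv_nonneg.2 (Nat.cast_nonneg N))]
    _ ≤ ENNReal.ofReal ((1 - u)⁻¹) * (ENNReal.ofReal ((N : ℝ)⁻¹) * (N * mfun d u)) := by gcongr
    _ = ENNReal.ofReal ((1 - u)⁻¹) * mfun d u := by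
        rw [ENNReal.ofReal_inv_of_pos hNpos, ENNReal.ofReal_natCast, ← mul_assoc ((N : ℝ≥0∞)⁻¹),
          ENNReal.inv_mul_cancel hN0 (ENNReal.natCast_ne_top N), one_mul]

end Main

/-! ### The endpoints: `θ ≤ f_N` and `f_N(a) → 0` below `p_c` -/

section Limits

variable {d : ℕ}

/-- `θ(u) ≤ f_N(u)` for `N ≥ 1`: on `{|C(0)| = ∞}` every `A_k` occurs (almost surely). -/
theorem theta_le_fN {N : ℕ} (hN : 1 ≤ N) (u : ℝ) :
    theta (zdGraph d) 0 (Set.projIcc 0 1 zero_le_one u) ≤ fN d N u := by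
  have hk : ∀ k, theta (zdGraph d) 0 (Set.projIcc 0 1 zero_le_one u) ≤ (P d u).real (sizeEvent d k) := by
    intro k
    unfold theta P
    refine DCT16.real_mono_of_forall_subset_edgeSet (zdGraph d) _ fun ω hω hperc => ?_
    rw [mem_sizeEvent, latt_eq_of_subset hω, Set.Infinite.encard_eq hperc]
    exact le_top
  have hN0 : (N : ℝ) ≠ 0 := by exact_mod_cast (show N ≠ 0 by omega)
  unfold fN
  calc theta (zdGraph d) 0 (Set.projIcc 0 1 zero_le_one u)
      = (N : ℝ)⁻¹ * ∑ _k ∈ Finset.Icc 1 N, theta (zdGraph d) 0 (Set.projIcc 0 1 zero_le_one u) := by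
        rw [Finset.sum_const, Nat.card_Icc, Nat.add_sub_cancel, nsmul_eq_mul, ← mul_assoc,
          inv_mul_cancel₀ hN0, one_mul]
    _ ≤ (N : ℝ)⁻¹ * ∑ k ∈ Finset.Icc 1 N, (P d u).real (sizeEvent d k) :=
        mul_le_mul_of_nonneg_left (Finset.sum_le_sum fun k _ => hk k) (inv_nonneg.2 (Nat.cast_nonneg N))

/-- Below `p_c`, `P_a(A_k) → 0` as `k → ∞` (`θ(a) = 0` and continuity of the measure along the
decreasing events `A_k`, whose intersection is `{|C(0)| = ∞}` almost surely). -/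
theorem tendsto_measure_sizeEvent {a : ℝ} (ha0 : 0 ≤ a) (ha : a < criticalProb (zdGraph d) 0) :
    Tendsto (fun k => (P d a) (sizeEvent d k)) atTop (𝓝 0) := by
  have hmem : a ∈ Set.Icc (0 : ℝ) 1 := ⟨ha0, ha.le.trans (criticalProb_mem_Icc _ _).2⟩
  have hθ : theta (zdGraph d) 0 (Set.projIcc 0 1 zero_le_one a) = 0 :=
    theta_eq_zero_of_lt_criticalProb_holds (zdGraph d) 0 _ (by rw [Set.projIcc_of_mem _ hmem]; exact ha)
  have hperc : (P d a) (percolatesAt 0) = 0 := by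
    have h : (P d a).real (percolatesAt 0) = 0 := hθ
    exact (measureReal_eq_zero_iff (measure_ne_top _ _)).1 h
  have hlim := tendsto_measure_iInter_atTop (μ := P d a) (s := sizeEvent d)
    (fun k => (measurableSet_sizeEvent d k).nullMeasurableSet) (sizeEvent_antitone d) ⟨0, measure_ne_top _ _⟩
  have h0 : (P d a) (⋂ k, sizeEvent d k) = 0 := by
    refine le_antisymm ?_ bot_le
    calc (P d a) (⋂ k, sizeEvent d k) ≤ (P d a) (percolatesAt 0) := measure_mono_ae ?_
      _ = 0 := hperc
    filter_upwards [ae_subset_edgeSet (d := d) a] with ω hω hI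
    have hI' : ∀ k, ω ∈ sizeEvent d k := Set.mem_iInter.1 hI
    change (openCluster ω 0).Infinite
    intro hfin
    have h := hI' (hfin.toFinset.card + 1)
    rw [mem_sizeEvent, latt_eq_of_subset hω, hfin.encard_eq_coe_toFinset_card] at h
    norm_cast at h
    omega
  rw [h0] at hlim
  exact hlim

/-- Below `p_c`, `f_N(a) → 0` as `N → ∞` (Cesàro). -/
theorem tendsto_fN {a : ℝ} (ha0 : 0 ≤ a) (ha : a < criticalProb (zdGraph d) 0) :
    Tendsto (fun N => fN d N a) atTop (𝓝 0) := by
  have h1 : Tendsto (fun k => (P d a).real (sizeEvent d k)) atTop (𝓝 0) := by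
    have := (ENNReal.tendsto_toReal ENNReal.zero_ne_top).comp (tendsto_measure_sizeEvent ha0 ha)
    rw [ENNReal.toReal_zero] at this
    exact this
  have h2 : Tendsto (fun k => (P d a).real (sizeEvent d (k + 1))) atTop (𝓝 0) :=
    (tendsto_add_atTop_iff_nat 1).2 h1
  have hs : ∀ N : ℕ, ∑ k ∈ Finset.Icc 1 N, (P d a).real (sizeEvent d k) =
      ∑ i ∈ Finset.range N, (P d a).real (sizeEvent d (i + 1)) := by
    intro N
    rw [← Finset.Ico_add_one_right_eq_Icc, Finset.sum_Ico_eq_sum_range, Nat.add_sub_cancel]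
    exact Finset.sum_congr rfl fun i _ => by rw [add_comm]
  refine h2.cesaro.congr fun N => ?_
  unfold fN
  rw [hs]

end Limits

end SwallowIneq

open SwallowIneq in
/-- **The swallow inequality** (route PercMinContact, support `SwallowInequality`,
stmt-CriticalPhenomena-11500): for bond percolation on `ℤ³` and every real `p < p_c`,
`θ(p_c) ≤ ∫_{(p, p_c)} (1 - u)⁻¹ m(u) du` in `[0, ∞]`, where
`m(u) = E_u[Σ_{y ∼ 0} 1{0 ↮ y} min(|C(0)|, |C(y)|)]`. Proof: for `a = max(p, p_c/2)` and every
`N`, `θ(p_c) ≤ f_N(p_c) = f_N(a) + ∫_a^{p_c} D_N ≤ f_N(a) + ∫_{(a,p_c)} (1-u)⁻¹ m(u) du`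
(Russo's formula for the truncated probe, the merger bound and the mass-transport principle:
`ofReal_DN_le`), and `f_N(a) → 0` since `θ(a) = 0`. -/
theorem swallowInequality_proof : Theses.PercMinContact.SwallowInequality := by
  intro p hp
  set pc := criticalProb (zdGraph 3) (0 : Site 3) with hpc
  have hpc01 := Grimmett1999_criticalProb_pos_lt_one_holds 3 (by norm_num)
  have hpc0 : 0 < pc := hpc01.1
  have hpc1 : pc < 1 := hpc01.2
  set a := max p (pc / 2) with ha
  have ha0 : 0 < a := lt_max_of_lt_right (by linarith)
  have hapc : a < pc := max_lt hp (by linarith)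
  have hpa : p ≤ a := le_max_left _ _
  have hθ : theta (zdGraph 3) 0 (criticalProbI 3) = theta (zdGraph 3) 0 (Set.projIcc 0 1 zero_le_one pc) := by
    congr 1
    apply Subtype.ext
    rw [Set.projIcc_of_mem _ ⟨hpc0.le, hpc1.le⟩]
    rfl
  set I := ∫⁻ u in Set.Ioo p pc, ENNReal.ofReal ((1 - u)⁻¹) * mfun 3 u with hI
  have hbound : ∀ N : ℕ, ENNReal.ofReal (theta (zdGraph 3) 0 (criticalProbI 3)) ≤
      ENNReal.ofReal (fN 3 (N + 1) a) + I := by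
    intro N
    have hN : 1 ≤ N + 1 := by omega
    calc ENNReal.ofReal (theta (zdGraph 3) 0 (criticalProbI 3))
        ≤ ENNReal.ofReal (fN 3 (N + 1) pc) := by
          rw [hθ]; exact ENNReal.ofReal_le_ofReal (theta_le_fN hN pc)
      _ = ENNReal.ofReal (fN 3 (N + 1) a + (fN 3 (N + 1) pc - fN 3 (N + 1) a)) := by rw [add_sub_cancel]
      _ ≤ ENNReal.ofReal (fN 3 (N + 1) a) + ENNReal.ofReal (fN 3 (N + 1) pc - fN 3 (N + 1) a) :=
          ENNReal.ofReal_add_le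
      _ = ENNReal.ofReal (fN 3 (N + 1) a) + ∫⁻ u in Set.Ioo a pc, ENNReal.ofReal (DN 3 (N + 1) u) := by
          rw [ofReal_fN_sub (N + 1) ha0 hapc.le hpc1]
      _ ≤ ENNReal.ofReal (fN 3 (N + 1) a) + ∫⁻ u in Set.Ioo a pc, ENNReal.ofReal ((1 - u)⁻¹) * mfun 3 u :=
          add_le_add (le_refl _) (setLIntegral_mono' measurableSet_Ioo fun u hu =>
            ofReal_DN_le hN ⟨ha0.trans hu.1, hu.2.trans hpc1⟩)
      _ ≤ ENNReal.ofReal (fN 3 (N + 1) a) + I :=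
          add_le_add (le_refl _) (lintegral_mono_set (Set.Ioo_subset_Ioo_left hpa))
  have hlim : Tendsto (fun N : ℕ => ENNReal.ofReal (fN 3 (N + 1) a) + I) atTop
      (𝓝 (ENNReal.ofReal 0 + I)) := by
    refine Tendsto.add ?_ tendsto_const_nhds
    exact ENNReal.tendsto_ofReal ((tendsto_add_atTop_iff_nat 1).2 (tendsto_fN ha0.le hapc))
  rw [ENNReal.ofReal_zero, zero_add] at hlim
  exact ge_of_tendsto' hlim hbound

end Summit.CriticalPhenomena.PercolationContinuityZ3.Theorems
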